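import Summits.QuantumFields.YangMills.Theorems.BalabanUVNodesK0RecordFormatNamesIntLocal
import Summits.QuantumFields.YangMills.Theorems.BalabanUVNodesPortS1Assembly

/-!
# K0⁷ record FORMAT⁺ names — lemma file 8: the EDITION-13 venue (`IntLocalFormula`) AT WORK — `Iff.rfl` faces against the residue's raw binders, additivity of the
# three receipts under `IntLocalFormula.add`, and ★ the (S1) mould ∕ the residue of 27930⁸ FROM ONE OBJECT (porter PT-A-1's assembly in one line)

DEFINER seat `ym-nodeO-def-1` (gen 34), port-lead O-2.  Kernel-checked bookkeeping over `…K0RecordFormatNamesIntLocal` (ed.13) and `…PortS1Assembly`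
(`formatPlusG_recordJ_of_intLocalResidue`, porter PT-A-1 ✓p797604); `--kind proof --supports stmt-QuantumFields-20541 --as helper`; count-neutral.

* §1 FACES (`Iff.rfl` ∕ `rfl`): (LOC)∕(GI) in the `intSites`∕`intShift`∕`intGaugeAct` vocabulary; the receipts (a)(b)(f′) read through `IntFormula.piece` ∕ `pairCutAt`;
  `(A.add B).Ψ.piece = A.Ψ.piece + B.Ψ.piece`.
* §2 ADDITIVITY of the receipts under `add`: (a) sums of analytic pieces; (b) constants ADD (`E₁ + E₂`); (f′) for the sum of two functional families — so `Ψ_LZ + Ψ_FE` is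
  handled at the OBJECT level and the two-formula variants (`…₂`) become corollaries.
* §3 ★ `formatPlusG_recordJ_of_intLocalFormula`: the (S1) mould at 27930's names from ONE `IntLocalFormula (L^{k+1}·Mc)` + (a)(b)(f′) + the TokP9-reg shape (= the porter's
  assembly, rows (c)(d)(e) supplied by the object's fields); ★ `residue_of_intLocalFormula`: object + `ResidueAt` ⟹ the ∃-package the residue form of 27930⁸ quantifies
  (`…PortS1Residue.sig27930v8_of_residue`'s inner `∃ Ψ, …`, conjunct for conjunct by `Iff.rfl`).

HONEST FRAMING.  Bookkeeping; NO piece of Bałaban's is constructed; the residue (a)(b)(f′) is NOT proved; 27930⁸ OPEN; K0⁷ NOT closed; NODE O 0∕1; COUNT 8∕28 · K 1∕4 UNMOVED;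
finite 𝕋⁴ at fixed ε — not continuum ∕ OS ∕ Clay; the Yang–Mills mass gap is NOT proved by any of this.
-/

noncomputable section

open scoped BigOperators Matrix.Norms.L2Operator Topology

namespace Summit.QuantumFields.YangMills.Theorems.K0RecordFormatNames

open Literature.MathematicalPhysics.QuantumFieldTheory.Balaban1983to89
open Literature.MathematicalPhysics.QuantumFieldTheory.Balaban1983to89.Node00
open Literature.MathematicalPhysics.QuantumFieldTheory.Balaban1983to89.T4Continuum (T4Family)
open Literature.MathematicalPhysics.QuantumFieldTheory.Balaban1983to89.B15Eq112TorusCover (cover)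
open Literature.MathematicalPhysics.QuantumFieldTheory.Balaban1983to89.B14.Eq213MaximalDomains (cubeExt)
open _root_.Filter

/-! ## §1  Faces -/

/-- (LOC) in the `intSites ∕ intShift` vocabulary (`Iff.rfl`). [cite: Balaban1987RG1, (1.7) p.261 (bookkeeping)] -/
theorem IntFormula.isLocal_iff (s : ℕ) (Ψ : IntFormula) :
    Ψ.IsLocal s ↔ ∀ (Xh : Finset (Fin 4 → ℤ)) (f f' : IntBondCfg),
      (∀ zμ, zμ.1 ∈ intSites s Xh → intShift zμ ∈ intSites s Xh → f zμ = f' zμ) → Ψ Xh f = Ψ Xh f' := Iff.rfl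

/-- (GI) in the `intGaugeAct` vocabulary (`Iff.rfl`). [cite: Balaban1987RG1, (1.19) p.263, (1.10) p.262 (bookkeeping)] -/
theorem IntFormula.isGaugeInv_iff (Ψ : IntFormula) :
    Ψ.IsGaugeInv ↔ ∀ (Xh : Finset (Fin 4 → ℤ)) (û : (Fin 4 → ℤ) → (MatA 2)ˣ), (∀ z, û z ∈ (B12RegularSpaces111SpecialUnitary.suModel 2).Gc) →
      ∀ f, Ψ Xh (intGaugeAct û f) = Ψ Xh f := Iff.rfl

/-- A formula factoring through a finite bond set inside the window is window-local, provided the set only holds bonds with both ends in the integer sites.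
[cite: Balaban1987RG1, (1.7) p.261 (bookkeeping)] -/
theorem IntFormula.isLocal_of_factorsThrough {s : ℕ} {Ψ : IntFormula} {S : Finset (Fin 4 → ℤ) → Finset ((Fin 4 → ℤ) × Fin 4)}
    (h : Ψ.FactorsThrough S) (hS : ∀ Xh, ∀ zμ ∈ S Xh, zμ.1 ∈ intSites s Xh ∧ intShift zμ ∈ intSites s Xh) : Ψ.IsLocal s :=
  fun Xh f f' hf => h Xh f f' fun zμ hz => hf zμ (hS Xh zμ hz).1 (hS Xh zμ hz).2

variable (F : T4Family)

/-- Unfolding the piece on pairs (`rfl`). [cite: Balaban1987RG1, (1.7) p.261 (bookkeeping)] -/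
theorem IntFormula.piece_eq (Ψ : IntFormula) (Mc k K : ℕ) (X : (recordDomSys F Mc k K).Dom) (φ : Sect2.CPair (F.P K) (MatA 2)) :
    Ψ.piece F Mc k K X φ = Ψ ((X.1 : Finset _).image (fun c (i : Fin 4) => (c i).valMinAbs))
      (fun zμ => (φ.1 ⟨cover (F.P K) zμ.1, zμ.2⟩, φ.2 ⟨cover (F.P K) zμ.1, zμ.2⟩)) := rfl

/-- The formula of a sum (`rfl`). [cite: Balaban1987RG1, p.261 L22–24 (bookkeeping)] -/
theorem IntLocalFormula.add_Ψ {s : ℕ} (A B : IntLocalFormula s) (Xh : Finset (Fin 4 → ℤ)) (f : IntBondCfg) :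
    (A.add B).Ψ Xh f = A.Ψ Xh f + B.Ψ Xh f := rfl

/-- The pieces of a sum are the sums of the pieces (`rfl`). [cite: Balaban1987RG1, p.261 L22–24 (bookkeeping)] -/
theorem IntLocalFormula.piece_add {s : ℕ} (A B : IntLocalFormula s) (Mc k K : ℕ) (X : (recordDomSys F Mc k K).Dom) (φ : Sect2.CPair (F.P K) (MatA 2)) :
    (A.add B).Ψ.piece F Mc k K X φ = A.Ψ.piece F Mc k K X φ + B.Ψ.piece F Mc k K X φ := rfl

/-- (a) read through `piece` (`Iff.rfl`). [cite: Balaban1987RG1, (1.18) p.263 (bookkeeping)] -/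
theorem IntFormula.analyticOnUc_iff (Ψ : IntFormula) (Mc k : ℕ) (α₀ α₁ : ℝ) :
    Ψ.AnalyticOnUc F Mc k α₀ α₁ ↔ ∀ n (X : (recordDomSys F Mc k (recordK₀ F Mc k + n)).Dom) (φ : Sect2.CPair (F.P (recordK₀ F Mc k + n)) (MatA 2)),
      encodeCfg F (recordK₀ F Mc k + n) φ ∈ recordUc F Mc k α₀ α₁ (recordK₀ F Mc k + n) X →
        AnalyticAt ℂ (fun ψ => Ψ.piece F Mc k (recordK₀ F Mc k + n) X ψ) φ := Iff.rfl

/-- (b) read through `piece` (`Iff.rfl`). [cite: Balaban1987RG1, (1.18) p.263 (bookkeeping)] -/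
theorem IntFormula.bound118OnUc_iff (Ψ : IntFormula) (Mc k : ℕ) (α₀ α₁ E₀ κ : ℝ) :
    Ψ.Bound118OnUc F Mc k α₀ α₁ E₀ κ ↔ ∀ n (X : (recordDomSys F Mc k (recordK₀ F Mc k + n)).Dom) (φ : Sect2.CPair (F.P (recordK₀ F Mc k + n)) (MatA 2)),
      encodeCfg F (recordK₀ F Mc k + n) φ ∈ recordUc F Mc k α₀ α₁ (recordK₀ F Mc k + n) X →
        ‖Ψ.piece F Mc k (recordK₀ F Mc k + n) X φ‖ ≤ E₀ * Real.exp (-κ * (recordDomSys F Mc k (recordK₀ F Mc k + n)).dj X) := Iff.rfl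

/-- (f′) read through `intCubes` and `pairCutAt` (`Iff.rfl`). [cite: Balaban1987RG1, (1.6)–(1.9) p.261 (bookkeeping)] -/
theorem IntFormula.represents_iff (Ψ : IntFormula) (a₀ ε₂₉ : ℝ) (Mc k : ℕ) (Φf : (n : ℕ) → recordW F a₀ ε₂₉ k (recordK₀ F Mc k + n) → ℂ) :
    Ψ.Represents F a₀ ε₂₉ Mc k Φf ↔ ∀ n, letI θ := thetaFill F a₀ ε₂₉; letI := θ.instVβ₁; letI := θ.instVβ₂; letI := θ.instιβ
      ∀ᶠ B in 𝓝 (0 : recordW F a₀ ε₂₉ k (recordK₀ F Mc k + n)),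
        Φf n B = ∑ X : (recordDomSys F Mc k (recordK₀ F Mc k + n)).Dom,
          Ψ (intCubes F Mc k (recordK₀ F Mc k + n) X) (pairCutAt F a₀ ε₂₉ Mc k (recordK₀ F Mc k + n) X B) := Iff.rfl

/-! ## §2  Additivity of the receipts under `IntLocalFormula.add` -/

/-- (a) for a sum. [cite: Balaban1987RG1, (1.18) p.263 (bookkeeping)] -/
theorem IntFormula.analyticOnUc_add {s : ℕ} (A B : IntLocalFormula s) (Mc k : ℕ) (α₀ α₁ : ℝ)
    (hA : A.Ψ.AnalyticOnUc F Mc k α₀ α₁) (hB : B.Ψ.AnalyticOnUc F Mc k α₀ α₁) : (A.add B).Ψ.AnalyticOnUc F Mc k α₀ α₁ :=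
  fun n X φ hφ => (hA n X φ hφ).add (hB n X φ hφ)

/-- (b) for a sum: the constants ADD (`E₁ + E₂` — print's two halves of (1.18)). [cite: Balaban1987RG1, (1.18) p.263, p.261 L22–24] -/
theorem IntFormula.bound118OnUc_add {s : ℕ} (A B : IntLocalFormula s) (Mc k : ℕ) (α₀ α₁ E₁ E₂ κ : ℝ)
    (hA : A.Ψ.Bound118OnUc F Mc k α₀ α₁ E₁ κ) (hB : B.Ψ.Bound118OnUc F Mc k α₀ α₁ E₂ κ) : (A.add B).Ψ.Bound118OnUc F Mc k α₀ α₁ (E₁ + E₂) κ := by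
  intro n X φ hφ
  rw [add_mul]
  exact (norm_add_le _ _).trans (add_le_add (hA n X φ hφ) (hB n X φ hφ))

/-- (f′) for a sum of two functional families. [cite: Balaban1987RG1, (1.3) p.260, (1.6)–(1.9) p.261 (bookkeeping)] -/
theorem IntFormula.represents_add {s : ℕ} (A B : IntLocalFormula s) (a₀ ε₂₉ : ℝ) (Mc k : ℕ)
    (ΦA ΦB : (n : ℕ) → recordW F a₀ ε₂₉ k (recordK₀ F Mc k + n) → ℂ)
    (hA : A.Ψ.Represents F a₀ ε₂₉ Mc k ΦA) (hB : B.Ψ.Represents F a₀ ε₂₉ Mc k ΦB) :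
    (A.add B).Ψ.Represents F a₀ ε₂₉ Mc k (fun n B => ΦA n B + ΦB n B) := by
  intro n
  filter_upwards [hA n, hB n] with B hAB hBB
  rw [hAB, hBB, ← Finset.sum_add_distrib]
  rfl

/-- `ResidueAt` for a sum of two objects representing two families (constants add). [cite: Balaban1987RG1, p.261 L22–24, (1.18) p.263 (bookkeeping)] -/
theorem IntLocalFormula.residueAt_add (Mc k : ℕ) (A B : IntLocalFormula (F.L ^ (k + 1) * Mc)) (a₀ ε₂₉ α₀ α₁ E₁ E₂ κ : ℝ)
    (ΦA ΦB : (n : ℕ) → recordW F a₀ ε₂₉ k (recordK₀ F Mc k + n) → ℂ)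
    (hA : A.ResidueAt F Mc k a₀ ε₂₉ α₀ α₁ E₁ κ ΦA) (hB : B.ResidueAt F Mc k a₀ ε₂₉ α₀ α₁ E₂ κ ΦB) :
    (A.add B).ResidueAt F Mc k a₀ ε₂₉ α₀ α₁ (E₁ + E₂) κ (fun n B => ΦA n B + ΦB n B) :=
  ⟨IntFormula.analyticOnUc_add F A B Mc k α₀ α₁ hA.1 hB.1, IntFormula.bound118OnUc_add F A B Mc k α₀ α₁ E₁ E₂ κ hA.2.1 hB.2.1,
    IntFormula.represents_add F A B a₀ ε₂₉ Mc k ΦA ΦB hA.2.2 hB.2.2⟩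

/-! ## §3  ★ The (S1) mould and the residue FROM ONE OBJECT -/

/-- ★★ **THE (S1) MOULD AT 27930's NAMES FROM ONE `IntLocalFormula`** (porter PT-A-1's `formatPlusG_recordJ_of_intLocalResidue` with rows (c)(d)(e) fed by the object's fields):
TokP9-reg shape `hP9` + object `Ψ` + (a) `hA` + (b) `hB` + (f′) `hR` ⟹ `FormatPlusG` over the twelve record families with `E₀, κ`, for THIS `Φf`.
[cite: Balaban1987RG1, (1.6)–(1.9) p.261, (1.10) p.262, (1.18)–(1.19) p.263, (1.21) p.264; Balaban1985Variational, Prop. 9 p.309] -/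
theorem formatPlusG_recordJ_of_intLocalFormula (Mc k : ℕ) (hMc : McGuard F Mc) (a₀ ε₂₉ α₀ α₁ E₀ κ : ℝ)
    (Φf : (n : ℕ) → recordW F a₀ ε₂₉ k (recordK₀ F Mc k + n) → ℂ)
    (hP9 : ∀ n, letI θ := thetaFill F a₀ ε₂₉; letI := θ.instVβ₁; letI := θ.instVβ₂; letI := θ.instιβ
      AnalyticAt ℝ (fun B : recordW F a₀ ε₂₉ k (recordK₀ F Mc k + n) =>
        fun (b : PBond (F.P (recordK₀ F Mc k + n)) 0) (i i' : Fin 2) =>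
          ((recordBgField F θ k (recordK₀ F Mc k + n) B b : SU 2) : Matrix (Fin 2) (Fin 2) ℂ) i i') 0)
    (Ψ : IntLocalFormula (F.L ^ (k + 1) * Mc)) (hA : Ψ.Ψ.AnalyticOnUc F Mc k α₀ α₁) (hB : Ψ.Ψ.Bound118OnUc F Mc k α₀ α₁ E₀ κ)
    (hR : Ψ.Ψ.Represents F a₀ ε₂₉ Mc k Φf) :
    letI θ := thetaFill F a₀ ε₂₉; letI := θ.instVβ₁; letI := θ.instVβ₂; letI := θ.instιβ
    B12FormatPlus.FormatPlusG
      (fun n => recordDomSys F Mc k (recordK₀ F Mc k + n)) (fun n => recordBondCount F (recordK₀ F Mc k + n))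
      (fun n => recordAct F (recordK₀ F Mc k + n)) (fun n => recordUc F Mc k α₀ α₁ (recordK₀ F Mc k + n))
      (fun n => recordCoords F Mc k (recordK₀ F Mc k + n)) (fun n => recordChartDimJ F (recordK₀ F Mc k + n))
      (fun n => recordChartJ F Mc k (recordK₀ F Mc k + n)) Φf
      (fun n => recordEmbJ F θ k (recordK₀ F Mc k + n))
      (fun n => recordWrapCtr F Mc k (recordK₀ F Mc k + n)) (fun n => recordDomEmbCtr F Mc k (recordK₀ F Mc k + n))
      (fun n _ => recordCoordProjCtr F (recordK₀ F Mc k + n)) E₀ κ :=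
  BalabanUVNodesPortS1.formatPlusG_recordJ_of_intLocalResidue F Mc k hMc a₀ ε₂₉ α₀ α₁ E₀ κ Φf hP9 Ψ.Ψ Ψ.isLocal Ψ.isGaugeInv hA hB hR

/-- ★ **THE RESIDUE's ∃-PACKAGE FROM ONE OBJECT**: an `IntLocalFormula (L^{k+1}·Mc)` with `ResidueAt … Φf` yields `∃ Ψ, (LOC) ∧ (GI) ∧ (a) ∧ (b) ∧ (f′)` — the inner existential of
`…PortS1Residue.sig27930v8_of_residue`'s hypothesis at `Φf := fun n => recordΦfAx F a₀ ε₂₉ k (prefixOf g k) (recordK₀ F Mc k + n)` (each conjunct `Iff.rfl` to the raw text).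
[cite: Balaban1987RG1, (1.7) p.261, (1.18)–(1.19) p.263, (1.6)–(1.9) p.261 (bookkeeping)] -/
theorem residue_of_intLocalFormula (Mc k : ℕ) (a₀ ε₂₉ α₀ α₁ E₀ κ : ℝ) (Φf : (n : ℕ) → recordW F a₀ ε₂₉ k (recordK₀ F Mc k + n) → ℂ)
    (Ψ : IntLocalFormula (F.L ^ (k + 1) * Mc)) (h : Ψ.ResidueAt F Mc k a₀ ε₂₉ α₀ α₁ E₀ κ Φf) :
    ∃ Ψ' : IntFormula, Ψ'.IsLocal (F.L ^ (k + 1) * Mc) ∧ Ψ'.IsGaugeInv ∧ Ψ'.AnalyticOnUc F Mc k α₀ α₁ ∧ Ψ'.Bound118OnUc F Mc k α₀ α₁ E₀ κ ∧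
      Ψ'.Represents F a₀ ε₂₉ Mc k Φf :=
  ⟨Ψ.Ψ, Ψ.isLocal, Ψ.isGaugeInv, h.1, h.2.1, h.2.2⟩

end Summit.QuantumFields.YangMills.Theorems.K0RecordFormatNames

end
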